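import Literature.Probability.RandomPlanarGeometry.HexSAWStripSurfaceWidthTwo
import Literature.Probability.RandomPlanarGeometry.HexSAWStripSurfaceLimits
import HarnessLib

/-!
# The width-two strip with a surface fugacity, solved at `x = x_c`: `B_2(x_c; y)` in closed form for `0 ≤ y < y_2`

Topic `Literature/Probability/RandomPlanarGeometry` (continues `HexSAWStripSurfaceWidthTwo.lean` — the `y`-weighted family sum
`W2.fsumY`, its exact decomposition `W2.fsumY_eq` through the weave transfer matrix `M(y) = [[x², x³y],[x³, x²y]]`, the resolvent
`W2.Rbot/Rtop = (I − M)⁻¹ g`, the threshold `W2.yTwo = (10 + 8√2)/7` — and `HexSAWStripSurfaceLimits.lean`: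
`HV.stripByLim T y = sup_L B_{T,L}(x_c; y)`).  This is the `y`-analogue of the tree's `HV.stripBlim_two_eq`
(`B_2(x_c) = (30√2 − 6)/49`, `HexSAWStripWidthTwo.lean`): for every `0 ≤ y < y_2` the weighted bridge generating function of the
width-two strip converges to an explicit rational function of `(x_c, y)`.

## What is proved (lane «pcv-sawmu», a-p2 g9)

* `W2.wsumY_linear` — linearity of the weave sums in the end weight;
* `W2.sum_wsumY_add_tail` — the resolvent identity `Σ_{n<N} M^n g + M^N (R g) = R g`;
* `W2.wsumY_le_geom` — geometric decay `M^N v ≤ C θ^N u` against the Collatz–Wielandt vector `u = R𝟙`, `θ = 1 − 1/(u_⊥ + u_⊤) < 1`;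
* `W2.tendsto_sum_wsumY` — `Σ_{n<N} (M^n g)_r → (R g)_r` for `0 ≤ g ≤ 𝟙` below `y_2`;
* `W2.limB2`, **`W2.tendsto_fsumY`** — the family sums converge to the closed form
  `2x_c[E(R1_⊥)_⊥ − E + (R1_⊤)_⊥ + E(E (R1_⊥)_⊤ + (R1_⊤)_⊤ − 1)] + 2x_c E`, `E = x_c³y/(1 − x_c⁴y)`;
* **`tendsto_stripGFy_two_beta`**, **`stripByLim_two_eq`** — `B_{2,L}(x_c; y) → B_2(x_c; y) = W2.limB2 y` and
  `stripByLim 2 y = W2.limB2 y` for every `0 ≤ y < y_2` (beyond `y*`, where the tree's general-T limit stops).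

Status in print: the `y = 1` series is printed (BGJ12 §2, `B_1(z)`, their width 1 = lane T = 2); the `y`-dependent closed form at
`x_c` is not located in print — lane corollary of the solved strip (label = lit's call).
-/

noncomputable section

open Finset Filter Topology

namespace Literature.Probability.RandomPlanarGeometry.SAW.HV

namespace W2

variable {x y : ℝ}

/-! ### Linearity and the resolvent identity -/

/-- Linearity of the weave sums in the end weight. [cite: BeatonBousquetMelouDeGierDuminilCopinGuttmann2014, §2, eq. (10) (arXiv v5 p. 6); lane: width-two transfer bookkeeping] -/
theorem wsumY_linear (x y : ℝ) (g : Bool → ℝ) (n : ℕ) (r : Bool) :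
    wsumY x y g n r = g false * wsumY x y (fun c => if c then 0 else 1) n r + g true * wsumY x y (fun c => if c then 1 else 0) n r := by
  unfold wsumY
  rw [Finset.mul_sum, Finset.mul_sum, ← Finset.sum_add_distrib]
  refine Finset.sum_congr rfl fun l _ => ?_
  cases wend r l <;> simp <;> ring

/-- **The resolvent identity** `Σ_{n<N} M^n g + M^N (R g) = R g` (both components).
[cite: BeatonBousquetMelouDeGierDuminilCopinGuttmann2014, Corollary 8 (arXiv v5 p. 12: the radius y_T of B_T(x_c;y)); lane: width-two transfer bookkeeping] -/
theorem sum_wsumY_add_tail (g : Bool → ℝ) (hdet : wdet x y ≠ 0) (N : ℕ) :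
    (∑ n ∈ Finset.range N, wsumY x y g n false) +
        wsumY x y (fun c => if c then Rtop x y g else Rbot x y g) N false = Rbot x y g ∧
      (∑ n ∈ Finset.range N, wsumY x y g n true) +
        wsumY x y (fun c => if c then Rtop x y g else Rbot x y g) N true = Rtop x y g := by
  induction N with
  | zero => simp [wsumY_zero]
  | succ N ih =>
    obtain ⟨ihb, iht⟩ := ih
    have hb := Rbot_eq g hdet
    have ht := Rtop_eq g hdet
    constructor
    · rw [Finset.sum_range_succ', wsumY_zero, wsumY_succ x y _ N false]
      simp only [wsumY_succ, if_true, Bool.true_eq_false, if_false, Finset.sum_add_distrib, ← Finset.mul_sum]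
      linear_combination x ^ 2 * ihb + x ^ 3 * y * iht + hb
    · rw [Finset.sum_range_succ', wsumY_zero, wsumY_succ x y _ N true]
      simp only [wsumY_succ, Bool.false_eq_true, if_false, if_true, Finset.sum_add_distrib, ← Finset.mul_sum]
      linear_combination x ^ 3 * ihb + x ^ 2 * y * iht + ht

/-! ### Geometric decay of `M^N` against the Collatz–Wielandt vector `u = R𝟙` -/

/-- `u_⊥ = (R𝟙)_⊥`. [cite: BeatonBousquetMelouDeGierDuminilCopinGuttmann2014, Corollary 8 (arXiv v5 p. 12); lane: width-two transfer bookkeeping] -/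
def uBot (x y : ℝ) : ℝ := Rbot x y fun _ => 1

/-- `u_⊤ = (R𝟙)_⊤`. [cite: BeatonBousquetMelouDeGierDuminilCopinGuttmann2014, Corollary 8 (arXiv v5 p. 12); lane: width-two transfer bookkeeping] -/
def uTop (x y : ℝ) : ℝ := Rtop x y fun _ => 1

/-- The contraction factor `θ = 1 − 1/(u_⊥ + u_⊤)`. [cite: BeatonBousquetMelouDeGierDuminilCopinGuttmann2014, Corollary 8 (arXiv v5 p. 12); lane: width-two transfer bookkeeping] -/
def theta (x y : ℝ) : ℝ := 1 - 1 / (uBot x y + uTop x y)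

/-- Basic facts on `u` and `θ` below the threshold: `u ≥ 1`, `M u = u − 𝟙 ≤ θ u`, `0 ≤ θ < 1`.
[cite: BeatonBousquetMelouDeGierDuminilCopinGuttmann2014, Corollary 8 (arXiv v5 p. 12); lane: width-two transfer bookkeeping] -/
theorem u_facts (hx : 0 ≤ x) (hy : 0 ≤ y) (hdet : 0 < wdet x y) (h1 : x ^ 2 * y ≤ 1) (h2 : x ^ 2 ≤ 1) :
    1 ≤ uBot x y ∧ 1 ≤ uTop x y ∧ 0 ≤ theta x y ∧ theta x y < 1 ∧
      x ^ 2 * uBot x y + x ^ 3 * y * uTop x y ≤ theta x y * uBot x y ∧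
      x ^ 3 * uBot x y + x ^ 2 * y * uTop x y ≤ theta x y * uTop x y := by
  have hb : 1 + x ^ 2 * uBot x y + x ^ 3 * y * uTop x y = uBot x y := Rbot_eq (x := x) (y := y) (fun _ => (1 : ℝ)) hdet.ne'
  have ht : 1 + x ^ 3 * uBot x y + x ^ 2 * y * uTop x y = uTop x y := Rtop_eq (x := x) (y := y) (fun _ => (1 : ℝ)) hdet.ne'
  have hx3y : 0 ≤ x ^ 3 * y := mul_nonneg (pow_nonneg hx 3) hy
  have hU0 : 0 ≤ uBot x y := by
    unfold uBot Rbot; exact div_nonneg (by nlinarith [sub_nonneg.2 h1]) hdet.le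
  have hT0 : 0 ≤ uTop x y := by
    unfold uTop Rtop; exact div_nonneg (by nlinarith [sub_nonneg.2 h2, pow_nonneg hx 3]) hdet.le
  have hMb : 0 ≤ x ^ 2 * uBot x y + x ^ 3 * y * uTop x y :=
    add_nonneg (mul_nonneg (pow_nonneg hx 2) hU0) (mul_nonneg hx3y hT0)
  have hMt : 0 ≤ x ^ 3 * uBot x y + x ^ 2 * y * uTop x y :=
    add_nonneg (mul_nonneg (pow_nonneg hx 3) hU0) (mul_nonneg (mul_nonneg (pow_nonneg hx 2) hy) hT0)
  have hUb1 : 1 ≤ uBot x y := by linarith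
  have hUt1 : 1 ≤ uTop x y := by linarith
  have hsum : 0 < uBot x y + uTop x y := by linarith
  have hinv : 1 / (uBot x y + uTop x y) ≤ 1 / 2 := one_div_le_one_div_of_le (by norm_num) (by linarith)
  have hinv0 : 0 < 1 / (uBot x y + uTop x y) := by positivity
  have hθb : theta x y * uBot x y = uBot x y - uBot x y / (uBot x y + uTop x y) := by unfold theta; ring
  have hθt : theta x y * uTop x y = uTop x y - uTop x y / (uBot x y + uTop x y) := by unfold theta; ring
  have hqb : uBot x y / (uBot x y + uTop x y) ≤ 1 := by rw [div_le_one hsum]; linarith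
  have hqt : uTop x y / (uBot x y + uTop x y) ≤ 1 := by rw [div_le_one hsum]; linarith
  refine ⟨hUb1, hUt1, ?_, ?_, ?_, ?_⟩
  · unfold theta; linarith
  · unfold theta; linarith
  · rw [hθb]; linarith
  · rw [hθt]; linarith

/-- **Geometric decay**: if `0 ≤ G ≤ C·u` then `(M^n G)_r ≤ C θ^n u_r`. [cite: BeatonBousquetMelouDeGierDuminilCopinGuttmann2014, Corollary 8 (arXiv v5 p. 12); lane: width-two transfer bookkeeping] -/
theorem wsumY_le_geom (hx : 0 ≤ x) (hy : 0 ≤ y) (hdet : 0 < wdet x y) (h1 : x ^ 2 * y ≤ 1) (h2 : x ^ 2 ≤ 1)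
    {G : Bool → ℝ} {C : ℝ} (hC : 0 ≤ C) (hGb : G false ≤ C * uBot x y) (hGt : G true ≤ C * uTop x y) (n : ℕ) :
    wsumY x y G n false ≤ C * theta x y ^ n * uBot x y ∧ wsumY x y G n true ≤ C * theta x y ^ n * uTop x y := by
  obtain ⟨-, -, hθ0, -, hMb, hMt⟩ := u_facts hx hy hdet h1 h2
  induction n with
  | zero => simp [wsumY_zero, hGb, hGt]
  | succ n ih =>
    obtain ⟨ihb, iht⟩ := ih
    have hc : 0 ≤ C * theta x y ^ n := mul_nonneg hC (pow_nonneg hθ0 n)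
    rw [wsumY_succ x y G n false, wsumY_succ x y G n true]
    simp only [if_true, Bool.true_eq_false, if_false, Bool.false_eq_true]
    constructor
    · calc x ^ 2 * wsumY x y G n false + x ^ 3 * y * wsumY x y G n true
          ≤ x ^ 2 * (C * theta x y ^ n * uBot x y) + x ^ 3 * y * (C * theta x y ^ n * uTop x y) :=
            add_le_add (mul_le_mul_of_nonneg_left ihb (pow_nonneg hx 2))
              (mul_le_mul_of_nonneg_left iht (mul_nonneg (pow_nonneg hx 3) hy))
        _ = C * theta x y ^ n * (x ^ 2 * uBot x y + x ^ 3 * y * uTop x y) := by ring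
        _ ≤ C * theta x y ^ n * (theta x y * uBot x y) := mul_le_mul_of_nonneg_left hMb hc
        _ = C * theta x y ^ (n + 1) * uBot x y := by ring
    · calc x ^ 3 * wsumY x y G n false + x ^ 2 * y * wsumY x y G n true
          ≤ x ^ 3 * (C * theta x y ^ n * uBot x y) + x ^ 2 * y * (C * theta x y ^ n * uTop x y) :=
            add_le_add (mul_le_mul_of_nonneg_left ihb (pow_nonneg hx 3))
              (mul_le_mul_of_nonneg_left iht (mul_nonneg (pow_nonneg hx 2) hy))
        _ = C * theta x y ^ n * (x ^ 3 * uBot x y + x ^ 2 * y * uTop x y) := by ring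
        _ ≤ C * theta x y ^ n * (theta x y * uTop x y) := mul_le_mul_of_nonneg_left hMt hc
        _ = C * theta x y ^ (n + 1) * uTop x y := by ring

/-- **Convergence of the weave series to the resolvent**: for an end weight `0 ≤ g ≤ 𝟙`, `Σ_{n<N} (M^n g)_r → (R g)_r` below the
threshold (`det(I − M) > 0`, `x²y ≤ 1`, `x² ≤ 1`). [cite: BeatonBousquetMelouDeGierDuminilCopinGuttmann2014, Corollary 8 (arXiv v5 p. 12); lane: width-two transfer bookkeeping] -/
theorem tendsto_sum_wsumY (hx : 0 ≤ x) (hy : 0 ≤ y) (hdet : 0 < wdet x y) (h1 : x ^ 2 * y ≤ 1) (h2 : x ^ 2 ≤ 1)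
    {g : Bool → ℝ} (hg0 : ∀ r, 0 ≤ g r) (hg1 : ∀ r, g r ≤ 1) :
    Tendsto (fun N => ∑ n ∈ Finset.range N, wsumY x y g n false) atTop (𝓝 (Rbot x y g)) ∧
      Tendsto (fun N => ∑ n ∈ Finset.range N, wsumY x y g n true) atTop (𝓝 (Rtop x y g)) := by
  obtain ⟨hUb1, hUt1, hθ0, hθ1, -, -⟩ := u_facts hx hy hdet h1 h2
  -- `R g ≤ u` componentwise (entrywise monotonicity of the resolvent)
  have hx3y : 0 ≤ x ^ 3 * y := mul_nonneg (pow_nonneg hx 3) hy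
  have hRb : Rbot x y g ≤ 1 * uBot x y := by
    rw [one_mul]; unfold uBot Rbot
    refine div_le_div_of_nonneg_right ?_ hdet.le
    nlinarith [mul_nonneg (sub_nonneg.2 h1) (sub_nonneg.2 (hg1 false)), mul_nonneg hx3y (sub_nonneg.2 (hg1 true))]
  have hRt : Rtop x y g ≤ 1 * uTop x y := by
    rw [one_mul]; unfold uTop Rtop
    refine div_le_div_of_nonneg_right ?_ hdet.le
    nlinarith [mul_nonneg (pow_nonneg hx 3) (sub_nonneg.2 (hg1 false)), mul_nonneg (sub_nonneg.2 h2) (sub_nonneg.2 (hg1 true))]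
  have hdec := fun N => wsumY_le_geom hx hy hdet h1 h2 (G := fun c => if c then Rtop x y g else Rbot x y g)
    zero_le_one (by simpa using hRb) (by simpa using hRt) N
  have hid := fun N => sum_wsumY_add_tail (x := x) (y := y) g hdet.ne' N
  have hRg0 : ∀ r, 0 ≤ (fun c : Bool => if c then Rtop x y g else Rbot x y g) r := by
    intro r; cases r
    · simp only [Bool.false_eq_true, if_false, Rbot]
      exact div_nonneg (by nlinarith [hg0 false, hg0 true, mul_nonneg hx3y (hg0 true), mul_nonneg (sub_nonneg.2 h1) (hg0 false)]) hdet.le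
    · simp only [if_true, Rtop]
      exact div_nonneg (by nlinarith [hg0 false, hg0 true, mul_nonneg (pow_nonneg hx 3) (hg0 false), mul_nonneg (sub_nonneg.2 h2) (hg0 true)]) hdet.le
  have hθN : Tendsto (fun N : ℕ => theta x y ^ N) atTop (𝓝 0) := tendsto_pow_atTop_nhds_zero_of_lt_one hθ0 hθ1
  constructor
  · -- Σ = R − tail, tail → 0
    have htail : Tendsto (fun N => wsumY x y (fun c => if c then Rtop x y g else Rbot x y g) N false) atTop (𝓝 0) := by
      refine squeeze_zero (fun N => wsumY_nonneg hx hy hRg0 N false) (fun N => (hdec N).1) ?_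
      simpa using (hθN.const_mul (1:ℝ)).mul_const (uBot x y)
    have : Tendsto (fun N => Rbot x y g - wsumY x y (fun c => if c then Rtop x y g else Rbot x y g) N false) atTop
        (𝓝 (Rbot x y g - 0)) := tendsto_const_nhds.sub htail
    rw [sub_zero] at this
    exact this.congr fun N => by linarith [(hid N).1]
  · have htail : Tendsto (fun N => wsumY x y (fun c => if c then Rtop x y g else Rbot x y g) N true) atTop (𝓝 0) := by
      refine squeeze_zero (fun N => wsumY_nonneg hx hy hRg0 N true) (fun N => (hdec N).2) ?_
      simpa using (hθN.const_mul (1:ℝ)).mul_const (uTop x y)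
    have : Tendsto (fun N => Rtop x y g - wsumY x y (fun c => if c then Rtop x y g else Rbot x y g) N true) atTop
        (𝓝 (Rtop x y g - 0)) := tendsto_const_nhds.sub htail
    rw [sub_zero] at this
    exact this.congr fun N => by linarith [(hid N).2]

/-! ### The limit of the family sums `W2.fsumY` -/

/-- The end weight `1_⊥`. [cite: BeatonBousquetMelouDeGierDuminilCopinGuttmann2014, §2, eq. (10) (arXiv v5 p. 6); lane: width-two transfer bookkeeping] -/
def oneBot : Bool → ℝ := fun c => if c then 0 else 1

/-- The end weight `1_⊤`. [cite: BeatonBousquetMelouDeGierDuminilCopinGuttmann2014, §2, eq. (10) (arXiv v5 p. 6); lane: width-two transfer bookkeeping] -/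
def oneTop : Bool → ℝ := fun c => if c then 1 else 0

/-- `E(y) = x_c³y/(1 − x_c⁴y)`: the excursion series `Σ_k x_c^{4k+3} y^{k+1}` in closed form.
[cite: DuminilCopinSmirnov2012, §3 (Fig. 3); lane: width-two bookkeeping] -/
def Einf (y : ℝ) : ℝ := hexCriticalFugacity ^ 3 * y / (1 - hexCriticalFugacity ^ 4 * y)

/-- **`B_2(x_c; y)` in closed form** (`0 ≤ y < y_2`):
`2x_c[E((R1_⊥)_⊥ − 1) + (R1_⊤)_⊥ + E(E (R1_⊥)_⊤ + (R1_⊤)_⊤ − 1)] + 2x_c E`, `R = (I − M(y))⁻¹` (`W2.Rbot/Rtop`), `E = W2.Einf y`;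
a rational function of `(x_c, y)` with denominator `det(I − M(y))·(1 − x_c⁴y)`, simple pole at `y_2`.
[cite: BeatonGuttmannJensen2012, §2 (B_1(z): the y = 1 series, their width 1 = lane T = 2); lane: the y-dependent value] -/
def limB2 (y : ℝ) : ℝ :=
  2 * (hexCriticalFugacity * ((Einf y * (Rbot hexCriticalFugacity y oneBot - 1) + Rbot hexCriticalFugacity y oneTop) +
    Einf y * (Einf y * Rtop hexCriticalFugacity y oneBot + (Rtop hexCriticalFugacity y oneTop - 1)))) +
  2 * (hexCriticalFugacity * Einf y)

/-- `rsumY = x³y · Σ_{k<N} (x⁴y)^k`. [cite: DuminilCopinSmirnov2012, §3 (Fig. 3); lane: width-two bookkeeping] -/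
theorem rsumY_eq_mul_geom (x y : ℝ) (N : ℕ) : rsumY x y N = x ^ 3 * y * ∑ k ∈ Finset.range N, (x ^ 4 * y) ^ k := by
  rw [rsumY, Finset.mul_sum]
  refine Finset.sum_congr rfl fun k _ => ?_
  rw [mul_pow, ← pow_mul, pow_succ, pow_add]
  ring

/-- `rsumY x y N → x³y/(1 − x⁴y)` when `0 ≤ x⁴y < 1`. [cite: DuminilCopinSmirnov2012, §3 (Fig. 3); lane: width-two bookkeeping] -/
theorem tendsto_rsumY (hx : 0 ≤ x) (hy : 0 ≤ y) (h : x ^ 4 * y < 1) :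
    Tendsto (rsumY x y) atTop (𝓝 (x ^ 3 * y / (1 - x ^ 4 * y))) := by
  have hr0 : 0 ≤ x ^ 4 * y := mul_nonneg (pow_nonneg hx 4) hy
  have h1 := ((hasSum_geometric_of_lt_one hr0 h).tendsto_sum_nat).const_mul (x ^ 3 * y)
  rw [div_eq_mul_inv]
  exact h1.congr fun N => (rsumY_eq_mul_geom x y N).symm

/-- `x_c⁴ y < 1` for `y ≤ y_2`. [cite: BeatonBousquetMelouDeGierDuminilCopinGuttmann2014, Corollary 8 (arXiv v5 p. 12: y_T); lane: width-two bookkeeping] -/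
theorem xc_four_mul_lt_one (hy : y ≤ yTwo) : hexCriticalFugacity ^ 4 * y < 1 := by
  have hx := hexCriticalFugacity_pos_lt_one
  have h1 := xc_sq_mul_le_one hy
  have hx2 : hexCriticalFugacity ^ 2 < 1 := by nlinarith [hx.1, hx.2]
  nlinarith [mul_nonneg (pow_nonneg hx.1.le 2) (sub_nonneg.2 h1)]

/-- `1 < y_2`. [cite: BeatonBousquetMelouDeGierDuminilCopinGuttmann2014, Corollary 8 (arXiv v5 p. 12: y_T); lane: the width-two value] -/
theorem one_lt_yTwo : 1 < yTwo := by
  rw [yTwo_eq]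
  have := Real.sqrt_nonneg 2
  linarith

/-- **The family sums converge to the closed form**: `W2.fsumY x_c y N → W2.limB2 y` for `0 ≤ y < y_2`.
[cite: BeatonBousquetMelouDeGierDuminilCopinGuttmann2014, Corollary 8 (arXiv v5 p. 12: y_T as the radius of B_T(x_c;y)); lane: width two, the value below the radius] -/
theorem tendsto_fsumY (hy0 : 0 ≤ y) (hlt : y < yTwo) : Tendsto (fsumY hexCriticalFugacity y) atTop (𝓝 (limB2 y)) := by
  set x := hexCriticalFugacity with hxdef
  have hx := hexCriticalFugacity_pos_lt_one
  have hx0 : 0 ≤ x := hx.1.le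
  have hdet : 0 < wdet x y := wdet_xc_pos hlt
  have h1 : x ^ 2 * y ≤ 1 := xc_sq_mul_le_one hlt.le
  have h2 : x ^ 2 ≤ 1 := by nlinarith [hx.1, hx.2]
  have h4 : x ^ 4 * y < 1 := xc_four_mul_lt_one hlt.le
  have hrs : Tendsto (rsumY x y) atTop (𝓝 (Einf y)) := tendsto_rsumY hx0 hy0 h4
  -- the resolvent limits for the end weights `1_⊥`, `1_⊤`
  have hB := tendsto_sum_wsumY hx0 hy0 hdet h1 h2 (g := oneBot) (fun r => by cases r <;> simp [oneBot])
    (fun r => by cases r <;> simp [oneBot])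
  have hT := tendsto_sum_wsumY hx0 hy0 hdet h1 h2 (g := oneTop) (fun r => by cases r <;> simp [oneTop])
    (fun r => by cases r <;> simp [oneTop])
  -- shifted sums `Σ_{n<N} W_{n+1}(r) = Σ_{n<N+1} W_n(r) − g(r)`
  have hshift : ∀ (g : Bool → ℝ) (r : Bool) (c : ℝ), Tendsto (fun N => ∑ n ∈ Finset.range N, wsumY x y g n r) atTop (𝓝 c) →
      Tendsto (fun N => ∑ n ∈ Finset.range N, wsumY x y g (n + 1) r) atTop (𝓝 (c - g r)) := by
    intro g r c h
    refine ((h.comp (tendsto_add_atTop_nat 1)).sub_const (g r)).congr fun N => ?_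
    simp only [Function.comp_apply, Finset.sum_range_succ', wsumY_zero, add_sub_cancel_right]
  have hPb := hshift oneBot false _ hB.1
  have hPt := hshift oneBot true _ hB.2
  have hQb := hshift oneTop false _ hT.1
  have hQt := hshift oneTop true _ hT.2
  -- linearity inside the sums of `fsumY_eq`
  have hlin : ∀ (N : ℕ) (r : Bool), ∑ n ∈ Finset.range N, wsumY x y (fun c => if c then 1 else rsumY x y N) (n + 1) r =
      rsumY x y N * ∑ n ∈ Finset.range N, wsumY x y oneBot (n + 1) r +
        ∑ n ∈ Finset.range N, wsumY x y oneTop (n + 1) r := by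
    intro N r
    rw [Finset.mul_sum, ← Finset.sum_add_distrib]
    refine Finset.sum_congr rfl fun n _ => ?_
    rw [wsumY_linear x y _ (n + 1) r]
    delta oneBot oneTop
    simp
  have hF : ∀ N, fsumY x y N =
      2 * (x * ((rsumY x y N * ∑ n ∈ Finset.range N, wsumY x y oneBot (n + 1) false +
          ∑ n ∈ Finset.range N, wsumY x y oneTop (n + 1) false) +
        rsumY x y N * (rsumY x y N * ∑ n ∈ Finset.range N, wsumY x y oneBot (n + 1) true +
          ∑ n ∈ Finset.range N, wsumY x y oneTop (n + 1) true))) +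
      2 * (x * rsumY x y N) := by
    intro N
    rw [fsumY_eq, hlin, hlin]
  have hlim := (((((hrs.mul hPb).add hQb).add (hrs.mul ((hrs.mul hPt).add hQt))).const_mul x).const_mul 2).add
    ((hrs.const_mul x).const_mul 2)
  have hfun : fsumY x y = fun N =>
      2 * (x * ((rsumY x y N * ∑ n ∈ Finset.range N, wsumY x y oneBot (n + 1) false +
          ∑ n ∈ Finset.range N, wsumY x y oneTop (n + 1) false) +
        rsumY x y N * (rsumY x y N * ∑ n ∈ Finset.range N, wsumY x y oneBot (n + 1) true +
          ∑ n ∈ Finset.range N, wsumY x y oneTop (n + 1) true))) +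
      2 * (x * rsumY x y N) := funext hF
  rw [hfun]
  convert hlim using 2
  simp only [limB2, oneBot, oneTop, if_true, Bool.false_eq_true, if_false, ← hxdef]
  ring

end W2

open W2

/-! ### `B_{2,L}(x_c; y) → B_2(x_c; y)` in closed form, for every `0 ≤ y < y_2` -/

/-- **`B_{2,L}(x_c; y) → W2.limB2 y`** for `0 ≤ y < y_2` — the solved width-two strip with a surface fugacity, beyond `y*`
(squeeze `fsumY N ≤ B_{2,2N}`, `B_{2,L} ≤ fsumY (L+2)`, monotonicity in `L`).
[cite: BeatonBousquetMelouDeGierDuminilCopinGuttmann2014, Corollary 8 (arXiv v5 p. 12: y_T is the radius of B_T(x_c; y)); lane corollary: the width-two value below the radius, not stated in print] -/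
theorem tendsto_stripGFy_two_beta {y : ℝ} (hy0 : 0 ≤ y) (hlt : y < yTwo) :
    Tendsto (fun L : ℕ => stripGFy 2 L (IsBetaDart 2) y) atTop (𝓝 (limB2 y)) := by
  have hmono : Monotone fun L : ℕ => stripGFy 2 L (IsBetaDart 2) y := fun L L' h => stripGFy_beta_mono_L h hy0
  have hbdd : BddAbove (Set.range fun L : ℕ => stripGFy 2 L (IsBetaDart 2) y) := (mem_stripBddSet_two_of_lt hy0 hlt).2
  have hB := tendsto_atTop_ciSup hmono hbdd
  have hF := tendsto_fsumY hy0 hlt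
  have hle : (⨆ L : ℕ, stripGFy 2 L (IsBetaDart 2) y) ≤ limB2 y :=
    le_of_tendsto_of_tendsto' hB (hF.comp (tendsto_add_atTop_nat 2)) fun L => stripGFy_le_fsumY hy0 L
  have hge : limB2 y ≤ ⨆ L : ℕ, stripGFy 2 L (IsBetaDart 2) y :=
    le_of_tendsto' hF fun N => (fsumY_le_stripGFy hy0 N).trans (le_ciSup hbdd (2 * N))
  rwa [le_antisymm hle hge] at hB

/-- **`B_2(x_c; y) = W2.limB2 y`** (`HV.stripByLim 2 y`, the supremum over `L`) for `0 ≤ y < y_2`.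
[cite: BeatonBousquetMelouDeGierDuminilCopinGuttmann2014, Corollary 8 (arXiv v5 p. 12); lane corollary: the width-two value, not stated in print] -/
theorem stripByLim_two_eq {y : ℝ} (hy0 : 0 ≤ y) (hlt : y < yTwo) : stripByLim 2 y = limB2 y := by
  have hmono : Monotone fun L : ℕ => stripGFy 2 L (IsBetaDart 2) y := fun L L' h => stripGFy_beta_mono_L h hy0
  have hbdd : BddAbove (Set.range fun L : ℕ => stripGFy 2 L (IsBetaDart 2) y) := (mem_stripBddSet_two_of_lt hy0 hlt).2
  exact tendsto_nhds_unique (tendsto_atTop_ciSup hmono hbdd) (tendsto_stripGFy_two_beta hy0 hlt)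

/-- The same with the explicit threshold `(10 + 8√2)/7`. [cite: BeatonBousquetMelouDeGierDuminilCopinGuttmann2014, Corollary 8 (arXiv v5 p. 12); lane corollary] -/
theorem stripByLim_two_eq' {y : ℝ} (hy0 : 0 ≤ y) (hlt : y < (10 + 8 * Real.sqrt 2) / 7) : stripByLim 2 y = limB2 y :=
  stripByLim_two_eq hy0 (yTwo_eq ▸ hlt)

/-- **Cross-check at `y = 1`**: the closed form reproduces the tree's independently computed `B_2(x_c) = (30√2 − 6)/49`
(`HV.stripBlim_two_eq`, via `HV.stripByLim_one`). [cite: BeatonGuttmannJensen2012, §2 (B_1(z), their width 1 = lane T = 2); lane: consistency of the two evaluations] -/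
theorem limB2_one : limB2 1 = (30 * Real.sqrt 2 - 6) / 49 := by
  rw [← stripByLim_two_eq zero_le_one one_lt_yTwo, stripByLim_one, stripBlim_two_eq]

end Literature.Probability.RandomPlanarGeometry.SAW.HV
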